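import Literature.Probability.RandomPlanarGeometry.TwoSidedEscapeIdentity
import Mathlib.Algebra.Field.GeomSum
import HarnessLib

/-!
# Escape from a two-sided path: removing the multiplicity of the root (Lawler's Prop. 3.6.3)

Seventh proof file of the `PlaneNonIntersection` story (named fact
`LSW2001_srw_nonIntersection_five_eighths`, `PlaneNonIntersection.lean`), fourth input of the
`k^{-1/2}` programme (Lawler 1991, (3.29) via §3.6). Lawler's identity (file
`TwoSidedEscapeIdentity.lean`) controls the escape probabilities summed over the DISTINCT vertices
of a path, i.e. over the roots that are last visits (`I⁺ = 1`); the probability `F` of interest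
has the root wherever it falls. Proposition 3.6.3 of the book (`E(e) ≤ (2d)² E(e I⁺) + (1-λ)`)
removes this restriction: a right half-path returning `r` times to the root before leaving it for
good is a loop with `r` excursions followed by a non-returning path; the loop only adds obstacles,
unless it covers all four neighbours of the root, in which case nothing escapes; and the
excursions' first steps are uniform and independent of their durations, so at most a fraction
`4 (3/4)^r` of the loops fails to cover. In the finite, fixed-horizon form proved here
(`sum_escProb_le_sixteen_mul`): for every finite `A₂`, `n ≥ 1`, `0 ≤ λ ≤ 1` and `N`,

  `Σ_{t ≤ N} (1-λ)λ^t 4^{-t} Σ_{β ∈ StepSeq 2 t} q_n(0; A₂ ∪ verts β)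
      ≤ 16 · Σ_{t ≤ N} (1-λ)λ^t 4^{-t} Σ_{β ∈ noRet t} q_n(0; A₂ ∪ verts β)`.

Ingredients: the last-return split (`sum_escProb_le_sum_card_loopsNC_mul`), the first-return split
and the induction over the number of returns (`sum_pow_card_fsLoops_le`), the symmetry of the
first step of an excursion under the lattice automorphisms (`card_excFirst_eq`), and
`Σ_σ 4^{-σ} #{excursions of length σ} ≤ 1` (`sum_card_excs_le`).

## References

* G. F. Lawler, *Intersections of Random Walks*, Birkhäuser 1991, Prop. 3.6.3 and its proof
  [Lawler1991].
-/

noncomputable section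

open Finset Real Literature.Probability.LatticeModels Literature.Probability.LatticeModels.SRW
open scoped BigOperators

namespace Literature.Probability.RandomPlanarGeometry

namespace PlaneNonIntersection

/-! ### Escape probabilities: monotonicity in the obstacle, covered start -/

/-- A larger obstacle set is escaped by fewer walks. [folklore] -/
theorem escSet_anti {m : ℕ} {y : Site 2} {A A' : Finset (Site 2)} (h : A ⊆ A') :
    escSet m y A' ⊆ escSet m y A := by
  intro ω hω
  rw [mem_escSet] at hω ⊢
  exact fun i hi hA => hω i hi (h hA)

/-- `q_m(y; A') ≤ q_m(y; A)` for `A ⊆ A'`. [folklore] -/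
theorem escProb_anti {m : ℕ} {y : Site 2} {A A' : Finset (Site 2)} (h : A ⊆ A') :
    escProb m y A' ≤ escProb m y A := by
  unfold escProb
  exact div_le_div_of_nonneg_right (by exact_mod_cast Finset.card_le_card (escSet_anti h))
    (by positivity)

/-- The first position of a walk is its first step. [folklore] -/
theorem pos_one {m : ℕ} (ω : StepSeq 2 m) (hm : 1 ≤ m) : pos ω 1 = stepVec (ω ⟨0, hm⟩) := by
  rw [show (1 : ℕ) = 0 + 1 from rfl, pos_succ ω hm, pos_zero, zero_add]

/-- If all four neighbours of `y` belong to the obstacle set, no walk of positive length escapes: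
`q_m(y; A) = 0`. [folklore] -/
theorem escProb_eq_zero_of_cover {m : ℕ} (hm : 1 ≤ m) {y : Site 2} {A : Finset (Site 2)}
    (h : ∀ v : Dir 2, y + stepVec v ∈ A) : escProb m y A = 0 := by
  unfold escProb
  rw [div_eq_zero_iff]
  left
  rw [Nat.cast_eq_zero, Finset.card_eq_zero, Finset.eq_empty_iff_forall_notMem]
  intro ω hω
  rw [mem_escSet] at hω
  have h0 := hω 0 hm
  rw [zero_add, pos_one ω hm] at h0
  exact h0 (h _)

/-! ### Vertex sets of the two pieces of a walk split at a zero -/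

/-- If `β(k) = 0`, the vertex set of `β` is the union of the vertex sets of its two pieces at
time `k`. [folklore] -/
theorem verts_eq_union_of_pos_eq_zero {t : ℕ} (β : StepSeq 2 t) {k : ℕ} (hk : k ≤ t)
    (h0 : pos β k = 0) : verts β = verts (pfxS β k hk) ∪ verts (sfxS β k) := by
  ext x
  rw [Finset.mem_union, mem_verts, mem_verts, mem_verts]
  constructor
  · rintro ⟨j, hj, rfl⟩
    by_cases hjk : j ≤ k
    · exact Or.inl ⟨j, hjk, pos_pfxS β hk hjk⟩
    · refine Or.inr ⟨j - k, by omega, ?_⟩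
      have h := pos_add_sfxS β hk (by omega : j - k ≤ t - k)
      rw [show k + (j - k) = j by omega, h0, zero_add] at h
      exact h.symm
  · rintro (⟨j, hj, rfl⟩ | ⟨j, hj, rfl⟩)
    · exact ⟨j, hj.trans hk, (pos_pfxS β hk hj).symm⟩
    · refine ⟨k + j, by omega, ?_⟩
      rw [pos_add_sfxS β hk hj, h0, zero_add]

/-! ### No-return paths, loops, covering -/

/-- The `t`-step walks that do not return to their start at times `1, …, t`. [folklore] -/
def noRet (t : ℕ) : Finset (StepSeq 2 t) := Finset.univ.filter fun β => ∀ i < t, pos β (i + 1) ≠ 0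

/-- Membership in `noRet`. [folklore] -/
theorem mem_noRet {t : ℕ} {β : StepSeq 2 t} : β ∈ noRet t ↔ ∀ i < t, pos β (i + 1) ≠ 0 := by
  simp [noRet]

/-- The `k`-step loops at the origin that do NOT visit all four neighbours of the origin.
[folklore] -/
def loopsNC (k : ℕ) : Finset (StepSeq 2 k) :=
  Finset.univ.filter fun θ => pos θ k = 0 ∧ ¬ ∀ v : Dir 2, stepVec v ∈ verts θ

/-! ### The last-return split -/

/-- **Last-return split**: splitting a right half-path at its last visit to the root,
`Σ_{β ∈ StepSeq 2 t} q_n(0; A₂ ∪ verts β) ≤ Σ_{k ≤ t} #loopsNC k · Σ_{β' ∈ noRet (t-k)} q_n(0; A₂ ∪ verts β')`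
(`n ≥ 1`: a covering loop kills the escape probability, a non-covering one is dropped from the
obstacle). [cite: Lawler1991, Prop. 3.6.3 (proof)] -/
theorem sum_escProb_le_sum_card_loopsNC_mul {n : ℕ} (hn : 1 ≤ n) (t : ℕ) (A₂ : Finset (Site 2)) :
    ∑ β : StepSeq 2 t, escProb n 0 (A₂ ∪ verts β) ≤
      ∑ k ∈ Finset.range (t + 1), (#(loopsNC k) : ℝ) *
        ∑ β' ∈ noRet (t - k), escProb n 0 (A₂ ∪ verts β') := by
  classical
  -- the classes "last zero at time `k`"
  let C : ℕ → Finset (StepSeq 2 t) := fun k =>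
    {β | pos β k = 0 ∧ ∀ i < t - k, pos β (k + (i + 1)) ≠ 0}
  have hcover : (Finset.univ : Finset (StepSeq 2 t)) = (Finset.range (t + 1)).biUnion C := by
    ext β
    simp only [Finset.mem_univ, Finset.mem_biUnion, Finset.mem_range, true_iff]
    let k := Nat.findGreatest (fun k => pos β k = 0) t
    have hk : pos β k = 0 := Nat.findGreatest_spec (P := fun k => pos β k = 0) (Nat.zero_le t) (pos_zero β)
    have hkt : k ≤ t := Nat.findGreatest_le t
    refine ⟨k, Nat.lt_succ_of_le hkt, ?_⟩
    simp only [C, Finset.mem_filter, Finset.mem_univ, true_and]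
    refine ⟨hk, fun i hi h => ?_⟩
    have := Nat.le_findGreatest (P := fun k => pos β k = 0) (by omega : k + (i + 1) ≤ t) h
    omega
  have hdisj : Set.PairwiseDisjoint (↑(Finset.range (t + 1)) : Set ℕ) C := by
    intro k hk k' hk' hne
    dsimp only [Function.onFun]
    rw [Finset.disjoint_filter]
    rintro β - ⟨h0, h1⟩ ⟨h0', h1'⟩
    rcases lt_or_gt_of_ne hne with hlt | hlt
    · have hk't : k' ≤ t := Nat.le_of_lt_succ (Finset.mem_range.1 hk')
      have h := h1 (k' - k - 1) (by omega)
      rw [show k + (k' - k - 1 + 1) = k' by omega] at h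
      exact h h0'
    · have hkt : k ≤ t := Nat.le_of_lt_succ (Finset.mem_range.1 hk)
      have h := h1' (k - k' - 1) (by omega)
      rw [show k' + (k - k' - 1 + 1) = k by omega] at h
      exact h h0
  -- the sum over all `β` as a sum over the classes
  have hsum : ∑ β : StepSeq 2 t, escProb n 0 (A₂ ∪ verts β) =
      ∑ k ∈ Finset.range (t + 1), ∑ β ∈ C k, escProb n 0 (A₂ ∪ verts β) := by
    rw [← Finset.sum_biUnion hdisj, ← hcover]
  rw [hsum]
  refine Finset.sum_le_sum fun k hk => ?_
  have hkt : k ≤ t := Nat.le_of_lt_succ (Finset.mem_range.1 hk)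
  -- the split form of the summand, transported along `splitEquivS hkt`
  let g : StepSeq 2 k × StepSeq 2 (t - k) → ℝ := fun p =>
    if (∀ v : Dir 2, stepVec v ∈ verts p.1) then 0 else escProb n 0 (A₂ ∪ verts p.2)
  have hle : ∀ β ∈ C k, escProb n 0 (A₂ ∪ verts β) ≤ g (splitEquivS hkt β) := by
    intro β hβ
    simp only [C, Finset.mem_filter, Finset.mem_univ, true_and] at hβ
    have hverts := verts_eq_union_of_pos_eq_zero β hkt hβ.1
    rw [splitEquivS_apply]
    simp only [g]
    split_ifs with hcov
    · refine le_of_eq (escProb_eq_zero_of_cover hn fun v => ?_)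
      rw [zero_add, hverts]
      exact Finset.mem_union_right _ (Finset.mem_union_left _ (hcov v))
    · refine escProb_anti ?_
      rw [hverts]
      exact Finset.union_subset_union (subset_refl _) Finset.subset_union_right
  have htrans : ∑ β ∈ C k, g (splitEquivS hkt β) =
      ∑ p ∈ (Finset.univ.filter fun θ : StepSeq 2 k => pos θ k = 0) ×ˢ noRet (t - k), g p := by
    refine Finset.sum_equiv (splitEquivS hkt) (fun β => ?_) (fun β _ => rfl)
    simp only [C, Finset.mem_filter, Finset.mem_univ, true_and, Finset.mem_product,
      splitEquivS_apply, mem_noRet]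
    rw [pos_pfxS β hkt le_rfl]
    refine and_congr_right fun h0 => forall₂_congr fun i hi => ?_
    rw [pos_add_sfxS β hkt (by omega : i + 1 ≤ t - k), h0, zero_add]
  have heval : ∑ p ∈ (Finset.univ.filter fun θ : StepSeq 2 k => pos θ k = 0) ×ˢ noRet (t - k), g p =
      (#(loopsNC k) : ℝ) * ∑ β' ∈ noRet (t - k), escProb n 0 (A₂ ∪ verts β') := by
    rw [Finset.sum_product]
    have h1 : ∀ θ ∈ (Finset.univ.filter fun θ : StepSeq 2 k => pos θ k = 0),
        ∑ β' ∈ noRet (t - k), g (θ, β') =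
          if (∀ v : Dir 2, stepVec v ∈ verts θ) then 0
          else ∑ β' ∈ noRet (t - k), escProb n 0 (A₂ ∪ verts β') := by
      intro θ _
      simp only [g]
      split_ifs <;> simp
    rw [Finset.sum_congr rfl h1, Finset.sum_ite, Finset.sum_const_zero, zero_add, Finset.sum_const,
      nsmul_eq_mul, Finset.filter_filter]
    rfl
  calc ∑ β ∈ C k, escProb n 0 (A₂ ∪ verts β) ≤ ∑ β ∈ C k, g (splitEquivS hkt β) :=
        Finset.sum_le_sum hle
    _ = _ := htrans
    _ = _ := heval

/-! ### Regrouping a triangular double sum -/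

/-- `Σ_{t ≤ N} Σ_{k ≤ t} a(k) b(t-k) ≤ (Σ_{k ≤ N} a(k)) (Σ_{s ≤ N} b(s))` for nonnegative `a, b`
(the map `(t, k) ↦ (k, t-k)` is injective into the square). [folklore] -/
theorem sum_sum_mul_sub_le {a b : ℕ → ℝ} (ha : ∀ k, 0 ≤ a k) (hb : ∀ s, 0 ≤ b s) (N : ℕ) :
    ∑ t ∈ Finset.range (N + 1), ∑ k ∈ Finset.range (t + 1), a k * b (t - k) ≤
      (∑ k ∈ Finset.range (N + 1), a k) * ∑ s ∈ Finset.range (N + 1), b s := by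
  classical
  set T : Finset (Σ _ : ℕ, ℕ) := (Finset.range (N + 1)).sigma fun t => Finset.range (t + 1) with hT
  set φ : (Σ _ : ℕ, ℕ) → ℕ × ℕ := fun p => (p.2, p.1 - p.2) with hφ
  have hinj : Set.InjOn φ T := by
    rintro ⟨t, k⟩ hp ⟨t', k'⟩ hp' h
    simp only [Finset.mem_coe, hT, Finset.mem_sigma, Finset.mem_range] at hp hp'
    simp only [hφ, Prod.mk.injEq] at h
    obtain ⟨h1, h2⟩ := h
    subst h1
    have : t = t' := by omega
    subst this
    rfl
  have hsub : T.image φ ⊆ Finset.range (N + 1) ×ˢ Finset.range (N + 1) := by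
    intro q hq
    rw [Finset.mem_image] at hq
    obtain ⟨⟨t, k⟩, hp, rfl⟩ := hq
    simp only [hT, Finset.mem_sigma, Finset.mem_range] at hp
    simp only [hφ, Finset.mem_product, Finset.mem_range]
    omega
  calc ∑ t ∈ Finset.range (N + 1), ∑ k ∈ Finset.range (t + 1), a k * b (t - k)
      = ∑ p ∈ T, a (φ p).1 * b (φ p).2 := by rw [hT, Finset.sum_sigma]
    _ = ∑ q ∈ T.image φ, a q.1 * b q.2 := by rw [Finset.sum_image hinj]
    _ ≤ ∑ q ∈ Finset.range (N + 1) ×ˢ Finset.range (N + 1), a q.1 * b q.2 :=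
        Finset.sum_le_sum_of_subset_of_nonneg hsub fun q _ _ => mul_nonneg (ha _) (hb _)
    _ = (∑ k ∈ Finset.range (N + 1), a k) * ∑ s ∈ Finset.range (N + 1), b s := by
        rw [Finset.sum_product, Finset.sum_mul_sum]

/-- `λ^t/4^t = (λ^k/4^k) (λ^{t-k}/4^{t-k})` for `k ≤ t`. [folklore] -/
theorem pow_div_pow_eq_mul {lam : ℝ} {t k : ℕ} (hk : k ≤ t) :
    lam ^ t / 4 ^ t = lam ^ k / 4 ^ k * (lam ^ (t - k) / 4 ^ (t - k)) := by
  conv_lhs => rw [← Nat.add_sub_cancel' hk, pow_add, pow_add]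
  field_simp

/-! ### Excursions and the first-return split -/

/-- The excursions of length `σ`: `σ`-step walks whose FIRST return to the start is at time `σ`
(`σ ≥ 1`). [folklore] -/
def excs (σ : ℕ) : Finset (StepSeq 2 σ) :=
  Finset.univ.filter fun ε => 1 ≤ σ ∧ pos ε σ = 0 ∧ ∀ i < σ - 1, pos ε (i + 1) ≠ 0

/-- The excursions of length `σ` whose first step is not `e_u`. [folklore] -/
def excsFS (σ : ℕ) (u : Dir 2) : Finset (StepSeq 2 σ) :=
  (excs σ).filter fun ε => pos ε 1 ≠ stepVec u

/-- The `k`-step loops at the origin with exactly `r` returns (at times `1, …, k`) that never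
step to `e_u` from the origin. [folklore] -/
def fsLoops (k r : ℕ) (u : Dir 2) : Finset (StepSeq 2 k) :=
  Finset.univ.filter fun θ => pos θ k = 0 ∧
    #((Finset.range k).filter fun i => pos θ (i + 1) = 0) = r ∧
    ∀ i < k, pos θ i = 0 → pos θ (i + 1) ≠ stepVec u

/-- **`Σ_σ #excs σ · 4^{N-σ} ≤ 4^N`**: the `N`-step walks split by the time of their first
return to the start are disjoint classes (the probabilities of first return at the various times
sum to at most one). [folklore] -/
theorem sum_card_excs_mul_le (N : ℕ) :
    ∑ σ ∈ Finset.range (N + 1), #(excs σ) * 4 ^ (N - σ) ≤ 4 ^ N := by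
  classical
  let C : ℕ → Finset (StepSeq 2 N) := fun σ =>
    {ω | 1 ≤ σ ∧ pos ω σ = 0 ∧ ∀ i < σ - 1, pos ω (i + 1) ≠ 0}
  have hC : ∀ σ ∈ Finset.range (N + 1), #(excs σ) * 4 ^ (N - σ) = #(C σ) := by
    intro σ hσ
    have hσN : σ ≤ N := Nat.le_of_lt_succ (Finset.mem_range.1 hσ)
    have h4 : 4 ^ (N - σ) = #(Finset.univ : Finset (StepSeq 2 (N - σ))) := by
      rw [Finset.card_univ, card_stepSeq]
    rw [h4, ← Finset.card_product]
    symm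
    refine Finset.card_equiv (splitEquivS hσN) fun ω => ?_
    simp only [C, excs, Finset.mem_filter, Finset.mem_univ, true_and, Finset.mem_product,
      splitEquivS_apply, and_true]
    rw [pos_pfxS ω hσN le_rfl]
    refine and_congr_right fun h1 => and_congr_right fun _ => forall₂_congr fun i hi => ?_
    rw [pos_pfxS ω hσN (by omega : i + 1 ≤ σ)]
  rw [Finset.sum_congr rfl hC, ← Finset.card_biUnion]
  · calc #((Finset.range (N + 1)).biUnion C) ≤ #(Finset.univ : Finset (StepSeq 2 N)) :=
        Finset.card_le_univ _
      _ = 4 ^ N := by rw [Finset.card_univ, card_stepSeq]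
  · intro σ hσ σ' hσ' hne
    dsimp only [Function.onFun]
    rw [Finset.disjoint_filter]
    rintro ω - ⟨h1, h0, hmin⟩ ⟨h1', h0', hmin'⟩
    rcases lt_or_gt_of_ne hne with hlt | hlt
    · exact hmin' (σ - 1) (by omega) (by rw [show σ - 1 + 1 = σ by omega]; exact h0)
    · exact hmin (σ' - 1) (by omega) (by rw [show σ' - 1 + 1 = σ' by omega]; exact h0')

/-- Real form: `Σ_{σ ≤ N} λ^σ/4^σ #excs σ ≤ 1` for `0 ≤ λ ≤ 1`. [folklore] -/
theorem sum_pow_div_card_excs_le {lam : ℝ} (hl0 : 0 ≤ lam) (hl1 : lam ≤ 1) (N : ℕ) :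
    ∑ σ ∈ Finset.range (N + 1), lam ^ σ / 4 ^ σ * #(excs σ) ≤ 1 := by
  have h := sum_card_excs_mul_le N
  have h' : (∑ σ ∈ Finset.range (N + 1), (#(excs σ) : ℝ) * 4 ^ (N - σ)) ≤ 4 ^ N := by
    exact_mod_cast h
  have h4 : (0 : ℝ) < 4 ^ N := by positivity
  calc ∑ σ ∈ Finset.range (N + 1), lam ^ σ / 4 ^ σ * #(excs σ)
      ≤ ∑ σ ∈ Finset.range (N + 1), (#(excs σ) : ℝ) * 4 ^ (N - σ) / 4 ^ N := by
        refine Finset.sum_le_sum fun σ hσ => ?_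
        have hσN : σ ≤ N := Nat.le_of_lt_succ (Finset.mem_range.1 hσ)
        have hl : lam ^ σ ≤ 1 := pow_le_one₀ hl0 hl1
        have heq : (#(excs σ) : ℝ) * 4 ^ (N - σ) / 4 ^ N = 1 / 4 ^ σ * #(excs σ) := by
          rw [show (4 : ℝ) ^ N = 4 ^ σ * 4 ^ (N - σ) by rw [← pow_add, Nat.add_sub_cancel' hσN]]
          field_simp
        rw [heq]
        exact mul_le_mul_of_nonneg_right (div_le_div_of_nonneg_right hl (by positivity))
          (Nat.cast_nonneg _)
    _ = (∑ σ ∈ Finset.range (N + 1), (#(excs σ) : ℝ) * 4 ^ (N - σ)) / 4 ^ N := by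
        rw [Finset.sum_div]
    _ ≤ 4 ^ N / 4 ^ N := div_le_div_of_nonneg_right h' h4.le
    _ = 1 := div_self h4.ne'

/-! ### Symmetry of the first step of an excursion -/

/-- Flipping the sign of the steps along the axis `a`. [folklore] -/
def flipDir (a : Fin 2) (v : Dir 2) : Dir 2 := if v.1 = a then v.neg else v

/-- Negating the coordinate `a`. [folklore] -/
def flipSite (a : Fin 2) (x : Site 2) : Site 2 := fun c => if c = a then -x c else x c

/-- Swapping the two axes of the steps. [folklore] -/
def swapDir (v : Dir 2) : Dir 2 := (v.1.rev, v.2)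

/-- Swapping the two coordinates. [folklore] -/
def swapSite (x : Site 2) : Site 2 := fun c => x c.rev

/-- `flipDir a` is an involution. [folklore] -/
theorem flipDir_flipDir (a : Fin 2) (v : Dir 2) : flipDir a (flipDir a v) = v := by
  unfold flipDir
  by_cases h : v.1 = a
  · rw [if_pos h, if_pos (by simp only [Dir.neg]; exact h), Dir.neg_neg]
  · rw [if_neg h, if_neg h]

/-- `swapDir` is an involution. [folklore] -/
theorem swapDir_swapDir (v : Dir 2) : swapDir (swapDir v) = v := by
  simp [swapDir, Fin.rev_rev]

/-- `flipSite a` is additive. [folklore] -/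
theorem flipSite_add (a : Fin 2) (x y : Site 2) : flipSite a (x + y) = flipSite a x + flipSite a y := by
  funext c; by_cases h : c = a <;> simp [flipSite, h]; ring

/-- `flipSite a 0 = 0`. [folklore] -/
theorem flipSite_zero (a : Fin 2) : flipSite a 0 = 0 := by
  funext c; by_cases h : c = a <;> simp [flipSite, h]

/-- `swapSite` is additive. [folklore] -/
theorem swapSite_add (x y : Site 2) : swapSite (x + y) = swapSite x + swapSite y := by
  funext c; simp [swapSite]

/-- `swapSite 0 = 0`. [folklore] -/
theorem swapSite_zero : swapSite (0 : Site 2) = 0 := by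
  funext c; simp [swapSite]

/-- `flipSite a x = 0 ↔ x = 0`. [folklore] -/
theorem flipSite_eq_zero_iff (a : Fin 2) (x : Site 2) : flipSite a x = 0 ↔ x = 0 := by
  constructor
  · intro h
    funext c
    have hc := congrFun h c
    by_cases h' : c = a
    · simp only [flipSite, h', if_true, Pi.zero_apply, neg_eq_zero] at hc
      subst h'
      exact hc
    · simpa [flipSite, h'] using hc
  · rintro rfl
    exact flipSite_zero a

/-- `swapSite x = 0 ↔ x = 0`. [folklore] -/
theorem swapSite_eq_zero_iff (x : Site 2) : swapSite x = 0 ↔ x = 0 := by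
  constructor
  · intro h
    funext c
    have hc := congrFun h c.rev
    simpa [swapSite, Fin.rev_rev] using hc
  · rintro rfl
    exact swapSite_zero

/-- The step of a flipped direction is the flipped step. [folklore] -/
theorem stepVec_flipDir (a : Fin 2) (v : Dir 2) : stepVec (flipDir a v) = flipSite a (stepVec v) := by
  obtain ⟨b, s⟩ := v
  funext c
  fin_cases a <;> fin_cases b <;> fin_cases c <;> cases s <;>
    simp [flipDir, flipSite, stepVec, Dir.neg]

/-- The step of a swapped direction is the swapped step. [folklore] -/
theorem stepVec_swapDir (v : Dir 2) : stepVec (swapDir v) = swapSite (stepVec v) := by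
  obtain ⟨b, s⟩ := v
  funext c
  fin_cases b <;> fin_cases c <;> cases s <;> simp [swapDir, swapSite, stepVec]

/-- Positions of a stepwise-transformed walk, for a step map compatible with an additive map of
the lattice. [folklore] -/
theorem pos_comp_eq {σ : ℕ} (g : Dir 2 → Dir 2) (L : Site 2 → Site 2)
    (hL : ∀ x y, L (x + y) = L x + L y) (hL0 : L 0 = 0) (hg : ∀ v, stepVec (g v) = L (stepVec v))
    (ε : StepSeq 2 σ) : ∀ j, j ≤ σ → pos (fun i => g (ε i)) j = L (pos ε j)
  | 0, _ => by rw [pos_zero, pos_zero, hL0]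
  | j + 1, hj => by
      have h : j < σ := hj
      rw [pos_succ _ h, pos_succ _ h, hL, pos_comp_eq g L hL hL0 hg ε j h.le, hg]

/-- A lattice symmetry transports the excursions with a given first step: for an involutive step
map `g` compatible with an additive map `L` of the lattice with trivial kernel,
`#{ε ∈ excs σ : ε(1) = e_v} = #{ε ∈ excs σ : ε(1) = e_{g v}}`. [folklore] -/
theorem card_excs_filter_eq_of_symm {σ : ℕ} (g : Dir 2 → Dir 2) (hg2 : ∀ v, g (g v) = v)
    (L : Site 2 → Site 2) (hL : ∀ x y, L (x + y) = L x + L y) (hL0 : ∀ x, L x = 0 ↔ x = 0)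
    (hg : ∀ v, stepVec (g v) = L (stepVec v)) (v : Dir 2) :
    #((excs σ).filter fun ε => pos ε 1 = stepVec v) =
      #((excs σ).filter fun ε => pos ε 1 = stepVec (g v)) := by
  have hL00 : L 0 = 0 := (hL0 0).2 rfl
  have hLinj : ∀ x y, L x = L y ↔ x = y := by
    intro x y
    constructor
    · intro h
      have h2 : L (x - y) + L y = L x := by rw [← hL, sub_add_cancel]
      have h1 : L (x - y) = 0 := by
        have h3 : L (x - y) + L y = 0 + L y := by rw [h2, h, zero_add]
        exact add_right_cancel h3
      exact sub_eq_zero.1 ((hL0 _).1 h1)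
    · rintro rfl
      rfl
  refine Finset.card_bijective (fun ε i => g (ε i))
    (Function.Involutive.bijective fun ε => by funext i; exact hg2 (ε i)) fun ε => ?_
  simp only [excs, Finset.mem_filter, Finset.mem_univ, true_and]
  have hpos : ∀ j ≤ σ, pos (fun i => g (ε i)) j = L (pos ε j) := fun j hj => pos_comp_eq g L hL hL00 hg ε j hj
  constructor
  · rintro ⟨⟨h1, h0, hmin⟩, hv⟩
    refine ⟨⟨h1, ?_, fun i hi => ?_⟩, ?_⟩
    · rw [hpos σ le_rfl, h0, hL00]
    · rw [hpos (i + 1) (by omega), Ne, hL0]; exact hmin i hi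
    · rw [hpos 1 h1, hv, hg]
  · rintro ⟨⟨h1, h0, hmin⟩, hv⟩
    refine ⟨⟨h1, ?_, fun i hi => ?_⟩, ?_⟩
    · rw [hpos σ le_rfl, hL0] at h0; exact h0
    · have := hmin i hi; rw [hpos (i + 1) (by omega), Ne, hL0] at this; exact this
    · rw [hpos 1 h1, hg, hLinj] at hv; exact hv

/-- **The first step of an excursion is uniform**: `#{ε ∈ excs σ : ε(1) = e_u}` does not depend on
the direction `u` (the four directions are related by sign flips and the axis swap). [folklore] -/
theorem card_excFirst_eq (σ : ℕ) (u v : Dir 2) :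
    #((excs σ).filter fun ε => pos ε 1 = stepVec u) = #((excs σ).filter fun ε => pos ε 1 = stepVec v) := by
  -- all four equal the count for `(0, true)`
  have hflip : ∀ (a : Fin 2) (w : Dir 2), #((excs σ).filter fun ε => pos ε 1 = stepVec w) =
      #((excs σ).filter fun ε => pos ε 1 = stepVec (flipDir a w)) := fun a w =>
    card_excs_filter_eq_of_symm (flipDir a) (flipDir_flipDir a) (flipSite a) (flipSite_add a)
      (flipSite_eq_zero_iff a) (stepVec_flipDir a) w
  have hswap : ∀ w : Dir 2, #((excs σ).filter fun ε => pos ε 1 = stepVec w) =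
      #((excs σ).filter fun ε => pos ε 1 = stepVec (swapDir w)) := fun w =>
    card_excs_filter_eq_of_symm swapDir swapDir_swapDir swapSite swapSite_add swapSite_eq_zero_iff
      stepVec_swapDir w
  have key : ∀ w : Dir 2, #((excs σ).filter fun ε => pos ε 1 = stepVec w) =
      #((excs σ).filter fun ε => pos ε 1 = stepVec (((0 : Fin 2), true) : Dir 2)) := by
    rintro ⟨b, s⟩
    fin_cases b <;> cases s
    · -- (0, false) = flipDir 0 (0, true)
      rw [hflip 0 ((0 : Fin 2), true)]; rfl
    · rfl
    · -- (1, false) = flipDir 1 (swapDir (0,true))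
      rw [hswap ((0 : Fin 2), true), hflip 1 (swapDir ((0 : Fin 2), true))]; rfl
    · -- (1, true) = swapDir (0, true)
      rw [hswap ((0 : Fin 2), true)]; rfl
  rw [key u, key v]

/-- `4 · #{ε ∈ excs σ : ε(1) = e_u} = #excs σ`. [folklore] -/
theorem four_mul_card_excFirst (σ : ℕ) (u : Dir 2) :
    4 * #((excs σ).filter fun ε => pos ε 1 = stepVec u) = #(excs σ) := by
  classical
  -- partition `excs σ` by the first step (an excursion has `σ ≥ 1`)
  have hpart : #(excs σ) = ∑ v : Dir 2, #((excs σ).filter fun ε => pos ε 1 = stepVec v) := by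
    rw [← Finset.card_biUnion]
    · congr 1
      ext ε
      simp only [Finset.mem_biUnion, Finset.mem_univ, true_and, Finset.mem_filter]
      constructor
      · intro hε
        have h1 : 1 ≤ σ := by
          simp only [excs, Finset.mem_filter, Finset.mem_univ, true_and] at hε; exact hε.1
        exact ⟨ε ⟨0, h1⟩, hε, pos_one ε h1⟩
      · rintro ⟨v, hε, -⟩; exact hε
    · intro v _ w _ hvw
      dsimp only [Function.onFun]
      rw [Finset.disjoint_filter]
      intro ε _ h1 h2
      exact hvw (stepVec_injective (h1.symm.trans h2))
  rw [hpart, Finset.sum_congr rfl fun v _ => card_excFirst_eq σ v u, Finset.sum_const, Finset.card_univ,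
    card_dir, smul_eq_mul]

/-- `4 · #excsFS σ u = 3 · #excs σ`: three quarters of the excursions avoid `e_u` at their first
step. [folklore] -/
theorem four_mul_card_excsFS (σ : ℕ) (u : Dir 2) : 4 * #(excsFS σ u) = 3 * #(excs σ) := by
  have h1 := four_mul_card_excFirst σ u
  have h3 : ((excs σ).filter fun ε => ¬ (pos ε 1 ≠ stepVec u)) =
      (excs σ).filter fun ε => pos ε 1 = stepVec u := by
    ext ε
    simp
  have h2 := Finset.card_filter_add_card_filter_not (s := excs σ) (fun ε => pos ε 1 ≠ stepVec u)
  rw [h3] at h2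
  rw [excsFS]
  omega

/-- `e_u ≤ 3/4`: `Σ_{σ ≤ N} λ^σ/4^σ #excsFS σ u ≤ 3/4`. [folklore] -/
theorem sum_pow_div_card_excsFS_le {lam : ℝ} (hl0 : 0 ≤ lam) (hl1 : lam ≤ 1) (N : ℕ) (u : Dir 2) :
    ∑ σ ∈ Finset.range (N + 1), lam ^ σ / 4 ^ σ * #(excsFS σ u) ≤ 3 / 4 := by
  have h : ∀ σ, (#(excsFS σ u) : ℝ) = 3 / 4 * #(excs σ) := by
    intro σ
    have := four_mul_card_excsFS σ u
    have h' : (4 : ℝ) * #(excsFS σ u) = 3 * #(excs σ) := by exact_mod_cast this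
    linarith
  simp_rw [h]
  calc ∑ σ ∈ Finset.range (N + 1), lam ^ σ / 4 ^ σ * (3 / 4 * #(excs σ))
      = 3 / 4 * ∑ σ ∈ Finset.range (N + 1), lam ^ σ / 4 ^ σ * #(excs σ) := by
        rw [Finset.mul_sum]; refine Finset.sum_congr rfl fun σ _ => ?_; ring
    _ ≤ 3 / 4 * 1 := by gcongr; exact sum_pow_div_card_excs_le hl0 hl1 N
    _ = 3 / 4 := by ring

/-! ### The first-return split and the induction over the number of returns -/

/-- Returns of a walk split at a zero: `#returns = #returns before σ + #returns of the suffix`,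
when `θ(σ) = 0`. [folklore] -/
theorem card_filter_returns_split {k : ℕ} (θ : StepSeq 2 k) {σ : ℕ} (hσ : σ ≤ k) (h0 : pos θ σ = 0) :
    #((Finset.range k).filter fun i => pos θ (i + 1) = 0) =
      #((Finset.range σ).filter fun i => pos θ (i + 1) = 0) +
        #((Finset.range (k - σ)).filter fun i => pos (sfxS θ σ) (i + 1) = 0) := by
  classical
  have hsplit : (Finset.range k).filter (fun i => pos θ (i + 1) = 0) =
      (Finset.range σ).filter (fun i => pos θ (i + 1) = 0) ∪
        ((Finset.Ico σ k).filter fun i => pos θ (i + 1) = 0) := by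
    rw [← Finset.filter_union, Finset.range_eq_Ico, Finset.range_eq_Ico,
      Finset.Ico_union_Ico_eq_Ico (Nat.zero_le σ) hσ]
  have hsfx : ∀ i, i < k - σ → (pos θ (σ + i + 1) = 0 ↔ pos (sfxS θ σ) (i + 1) = 0) := by
    intro i hi
    have h := pos_add_sfxS θ hσ (by omega : i + 1 ≤ k - σ)
    rw [show σ + (i + 1) = σ + i + 1 by omega, h0, zero_add] at h
    rw [h]
  rw [hsplit, Finset.card_union_of_disjoint]
  · congr 1
    refine Finset.card_bij' (fun i _ => i - σ) (fun i _ => σ + i) ?_ ?_ ?_ ?_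
    · intro i hi
      rw [Finset.mem_filter, Finset.mem_Ico] at hi
      rw [Finset.mem_filter, Finset.mem_range]
      refine ⟨by omega, ?_⟩
      rw [← hsfx (i - σ) (by omega), show σ + (i - σ) + 1 = i + 1 by omega]
      exact hi.2
    · intro i hi
      rw [Finset.mem_filter, Finset.mem_range] at hi
      rw [Finset.mem_filter, Finset.mem_Ico]
      refine ⟨⟨by omega, by omega⟩, ?_⟩
      rw [show σ + i + 1 = σ + i + 1 from rfl, hsfx i hi.1]
      exact hi.2
    · intro i hi
      rw [Finset.mem_filter, Finset.mem_Ico] at hi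
      omega
    · intro i _
      omega
  · rw [Finset.disjoint_left]
    intro i h1 h2
    rw [Finset.mem_filter, Finset.mem_range] at h1
    rw [Finset.mem_filter, Finset.mem_Ico] at h2
    omega

/-- **First-return split**: a loop with `r + 1` returns that never steps to `e_u` from the
origin splits, at its first return `σ`, into an excursion of length `σ` avoiding `e_u` at its
first step and a loop with `r` returns of the same kind:
`#fsLoops k (r+1) u ≤ Σ_{σ ≤ k} #excsFS σ u · #fsLoops (k-σ) r u`. [folklore] -/
theorem card_fsLoops_succ_le (k r : ℕ) (u : Dir 2) :
    #(fsLoops k (r + 1) u) ≤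
      ∑ σ ∈ Finset.range (k + 1), #(excsFS σ u) * #(fsLoops (k - σ) r u) := by
  classical
  -- the first return time
  have hex : ∀ θ ∈ fsLoops k (r + 1) u, ∃ σ, 1 ≤ σ ∧ σ ≤ k ∧ pos θ σ = 0 := by
    intro θ hθ
    simp only [fsLoops, Finset.mem_filter, Finset.mem_univ, true_and] at hθ
    obtain ⟨-, hr, -⟩ := hθ
    have hne : ((Finset.range k).filter fun i => pos θ (i + 1) = 0).Nonempty := by
      rw [← Finset.card_pos, hr]
      omega
    obtain ⟨i, hi⟩ := hne
    rw [Finset.mem_filter, Finset.mem_range] at hi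
    exact ⟨i + 1, by omega, by omega, hi.2⟩
  let σf : StepSeq 2 k → ℕ := fun θ => if h : θ ∈ fsLoops k (r + 1) u then Nat.find (hex θ h) else 0
  have hσk : ∀ θ, σf θ ≤ k := by
    intro θ
    by_cases h : θ ∈ fsLoops k (r + 1) u
    · have := (Nat.find_spec (hex θ h)).2.1
      simpa [σf, h] using this
    · simp [σf, h]
  have hσ : ∀ θ ∈ fsLoops k (r + 1) u, 1 ≤ σf θ ∧ pos θ (σf θ) = 0 ∧
      ∀ j, 1 ≤ j → j < σf θ → pos θ j ≠ 0 := by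
    intro θ hθ
    have hspec := Nat.find_spec (hex θ hθ)
    refine ⟨by simp only [σf, dif_pos hθ]; exact hspec.1,
      by simp only [σf, dif_pos hθ]; exact hspec.2.2, ?_⟩
    intro j hj1 hjlt hj0
    have hjlt' : j < Nat.find (hex θ hθ) := by
      simp only [σf, dif_pos hθ] at hjlt
      exact hjlt
    exact Nat.find_min (hex θ hθ) hjlt' ⟨hj1, by omega, hj0⟩
  -- the target and the map
  set S : Finset (Σ σ : ℕ, StepSeq 2 σ × StepSeq 2 (k - σ)) :=
    (Finset.range (k + 1)).sigma fun σ => excsFS σ u ×ˢ fsLoops (k - σ) r u with hS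
  let f : StepSeq 2 k → (Σ σ : ℕ, StepSeq 2 σ × StepSeq 2 (k - σ)) := fun θ =>
    ⟨σf θ, (pfxS θ (σf θ) (hσk θ), sfxS θ (σf θ))⟩
  let g : (Σ σ : ℕ, StepSeq 2 σ × StepSeq 2 (k - σ)) → StepSeq 2 k := fun p =>
    if h : p.1 ≤ k then (splitEquivS h).symm p.2 else fun _ => default
  have hgf : ∀ θ, g (f θ) = θ := by
    intro θ
    simp only [f, g, dif_pos (hσk θ)]
    exact (splitEquivS (hσk θ)).symm_apply_apply θ
  have hmaps : ∀ θ ∈ fsLoops k (r + 1) u, f θ ∈ S := by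
    intro θ hθ
    obtain ⟨h1, h0, hmin⟩ := hσ θ hθ
    have hθ' := hθ
    simp only [fsLoops, Finset.mem_filter, Finset.mem_univ, true_and] at hθ'
    obtain ⟨hk0, hret, hfs⟩ := hθ'
    have hle := hσk θ
    simp only [hS, f, Finset.mem_sigma, Finset.mem_range, Finset.mem_product]
    refine ⟨Nat.lt_succ_of_le hle, ?_, ?_⟩
    · -- the prefix is an excursion avoiding `e_u` at its first step
      simp only [excsFS, excs, Finset.mem_filter, Finset.mem_univ, true_and]
      refine ⟨⟨h1, by rw [pos_pfxS θ hle le_rfl]; exact h0, fun i hi => ?_⟩, ?_⟩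
      · rw [pos_pfxS θ hle (by omega : i + 1 ≤ σf θ)]
        exact hmin (i + 1) (by omega) (by omega)
      · rw [pos_pfxS θ hle h1]
        have := hfs 0 (by omega) (pos_zero θ)
        rwa [zero_add] at this
    · -- the suffix is a loop with `r` returns of the same kind
      simp only [fsLoops, Finset.mem_filter, Finset.mem_univ, true_and]
      have hpos : ∀ i ≤ k - σf θ, pos θ (σf θ + i) = pos (sfxS θ (σf θ)) i := by
        intro i hi
        rw [pos_add_sfxS θ hle hi, h0, zero_add]
      refine ⟨?_, ?_, fun i hi hi0 => ?_⟩
      · rw [← hpos (k - σf θ) le_rfl, Nat.add_sub_cancel' hle]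
        exact hk0
      · have hsplit := card_filter_returns_split θ hle h0
        have hone : #((Finset.range (σf θ)).filter fun i => pos θ (i + 1) = 0) = 1 := by
          rw [Finset.card_eq_one]
          refine ⟨σf θ - 1, ?_⟩
          ext i
          rw [Finset.mem_filter, Finset.mem_range, Finset.mem_singleton]
          constructor
          · rintro ⟨hi, hi0⟩
            by_contra hne
            exact hmin (i + 1) (by omega) (by omega) hi0
          · rintro rfl
            refine ⟨by omega, ?_⟩
            rw [show σf θ - 1 + 1 = σf θ by omega]
            exact h0
        omega
      · have h2 := hfs (σf θ + i) (by omega) (by rw [hpos i hi.le]; exact hi0)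
        rw [show σf θ + i + 1 = σf θ + (i + 1) by ring, hpos (i + 1) hi] at h2
        exact h2
  have hinj : Set.InjOn f (fsLoops k (r + 1) u) := fun θ _ θ' _ h => by
    rw [← hgf θ, ← hgf θ', h]
  calc #(fsLoops k (r + 1) u) ≤ #S := Finset.card_le_card_of_injOn f hmaps hinj
    _ = ∑ σ ∈ Finset.range (k + 1), #(excsFS σ u) * #(fsLoops (k - σ) r u) := by
        rw [hS, Finset.card_sigma]
        exact Finset.sum_congr rfl fun σ _ => Finset.card_product _ _

/-- **Induction over the number of returns**: `Σ_{k ≤ N} λ^k/4^k #fsLoops k r u ≤ (3/4)^r`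
(`0 ≤ λ ≤ 1`): each return costs an excursion avoiding `e_u`, of total weight `e_u ≤ 3/4`.
[cite: Lawler1991, Prop. 3.6.3 (proof)] -/
theorem sum_pow_div_card_fsLoops_le {lam : ℝ} (hl0 : 0 ≤ lam) (hl1 : lam ≤ 1) (u : Dir 2) (N : ℕ) :
    ∀ r : ℕ, ∑ k ∈ Finset.range (N + 1), lam ^ k / 4 ^ k * #(fsLoops k r u) ≤ (3 / 4) ^ r
  | 0 => by
      -- only the empty loop has no return
      have hzero : ∀ k, 1 ≤ k → fsLoops k 0 u = ∅ := by
        intro k hk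
        rw [Finset.eq_empty_iff_forall_notMem]
        intro θ hθ
        simp only [fsLoops, Finset.mem_filter, Finset.mem_univ, true_and] at hθ
        obtain ⟨h0, hr, -⟩ := hθ
        rw [Finset.card_eq_zero, Finset.filter_eq_empty_iff] at hr
        exact hr (Finset.mem_range.2 (by omega : k - 1 < k))
          (by rw [show k - 1 + 1 = k by omega]; exact h0)
      rw [Finset.sum_range_succ']
      rw [Finset.sum_eq_zero fun k _ => by rw [hzero (k + 1) (by omega)]; simp]
      have h1 : #(fsLoops 0 0 u) ≤ 1 := by
        calc #(fsLoops 0 0 u) ≤ #(Finset.univ : Finset (StepSeq 2 0)) := Finset.card_le_univ _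
          _ = 1 := by rw [Finset.card_univ, card_stepSeq]; rfl
      have h1' : (#(fsLoops 0 0 u) : ℝ) ≤ 1 := by exact_mod_cast h1
      simp only [pow_zero, div_one, one_mul, zero_add]
      exact h1'
  | r + 1 => by
      have ih := sum_pow_div_card_fsLoops_le hl0 hl1 u N r
      set a : ℕ → ℝ := fun σ => lam ^ σ / 4 ^ σ * #(excsFS σ u) with ha
      set b : ℕ → ℝ := fun s => lam ^ s / 4 ^ s * #(fsLoops s r u) with hb
      have ha0 : ∀ σ, 0 ≤ a σ := fun σ => by rw [ha]; positivity
      have hb0 : ∀ s, 0 ≤ b s := fun s => by rw [hb]; positivity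
      calc ∑ k ∈ Finset.range (N + 1), lam ^ k / 4 ^ k * #(fsLoops k (r + 1) u)
          ≤ ∑ k ∈ Finset.range (N + 1), lam ^ k / 4 ^ k *
              ∑ σ ∈ Finset.range (k + 1), (#(excsFS σ u) : ℝ) * #(fsLoops (k - σ) r u) := by
            refine Finset.sum_le_sum fun k _ => mul_le_mul_of_nonneg_left ?_ (by positivity)
            exact_mod_cast card_fsLoops_succ_le k r u
        _ = ∑ k ∈ Finset.range (N + 1), ∑ σ ∈ Finset.range (k + 1), a σ * b (k - σ) := by
            refine Finset.sum_congr rfl fun k _ => ?_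
            rw [Finset.mul_sum]
            refine Finset.sum_congr rfl fun σ hσ => ?_
            have hσk : σ ≤ k := Nat.le_of_lt_succ (Finset.mem_range.1 hσ)
            rw [ha, hb]
            dsimp only
            rw [pow_div_pow_eq_mul hσk (lam := lam)]
            ring
        _ ≤ (∑ σ ∈ Finset.range (N + 1), a σ) * ∑ s ∈ Finset.range (N + 1), b s :=
            sum_sum_mul_sub_le ha0 hb0 N
        _ ≤ 3 / 4 * (3 / 4) ^ r :=
            mul_le_mul (sum_pow_div_card_excsFS_le hl0 hl1 N u) ih
              (Finset.sum_nonneg fun s _ => hb0 s) (by norm_num)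
        _ = (3 / 4) ^ (r + 1) := by ring

/-- The non-covering loops are among the loops that avoid some neighbour from the origin:
`#loopsNC k ≤ Σ_u Σ_{r ≤ k} #fsLoops k r u`. [folklore] -/
theorem card_loopsNC_le (k : ℕ) :
    #(loopsNC k) ≤ ∑ u : Dir 2, ∑ r ∈ Finset.range (k + 1), #(fsLoops k r u) := by
  classical
  calc #(loopsNC k)
      ≤ #((Finset.univ : Finset (Dir 2)).biUnion fun u =>
          (Finset.range (k + 1)).biUnion fun r => fsLoops k r u) := by
        refine Finset.card_le_card fun θ hθ => ?_
        simp only [loopsNC, Finset.mem_filter, Finset.mem_univ, true_and] at hθ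
        obtain ⟨h0, hnc⟩ := hθ
        obtain ⟨u, hu⟩ := not_forall.1 hnc
        simp only [Finset.mem_biUnion, Finset.mem_univ, true_and, Finset.mem_range]
        refine ⟨u, #((Finset.range k).filter fun i => pos θ (i + 1) = 0), ?_, ?_⟩
        · calc #((Finset.range k).filter fun i => pos θ (i + 1) = 0) ≤ #(Finset.range k) :=
              Finset.card_filter_le _ _
            _ < k + 1 := by rw [Finset.card_range]; omega
        · rw [fsLoops, Finset.mem_filter]
          refine ⟨Finset.mem_univ _, h0, rfl, fun i hi _ h => hu ?_⟩
          rw [← h]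
          exact pos_mem_verts θ (by omega : i + 1 ≤ k)
    _ ≤ ∑ u : Dir 2, #((Finset.range (k + 1)).biUnion fun r => fsLoops k r u) := Finset.card_biUnion_le
    _ ≤ ∑ u : Dir 2, ∑ r ∈ Finset.range (k + 1), #(fsLoops k r u) :=
        Finset.sum_le_sum fun u _ => Finset.card_biUnion_le

/-- **`Λ ≤ 16`**: `Σ_{k ≤ N} λ^k/4^k #loopsNC k ≤ 16` — Lawler's `(2d)² = Σ_u Σ_r (3/4)^r`.
[cite: Lawler1991, Prop. 3.6.3] -/
theorem sum_pow_div_card_loopsNC_le {lam : ℝ} (hl0 : 0 ≤ lam) (hl1 : lam ≤ 1) (N : ℕ) :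
    ∑ k ∈ Finset.range (N + 1), lam ^ k / 4 ^ k * #(loopsNC k) ≤ 16 := by
  have hgeom : ∑ r ∈ Finset.range (N + 1), (3 / 4 : ℝ) ^ r ≤ 4 := by
    rw [geom_sum_eq (by norm_num) (N + 1)]
    have : (0 : ℝ) ≤ (3 / 4) ^ (N + 1) := by positivity
    have h2 : ((3 / 4 : ℝ) ^ (N + 1) - 1) / (3 / 4 - 1) = 4 * (1 - (3 / 4) ^ (N + 1)) := by ring
    rw [h2]
    linarith
  calc ∑ k ∈ Finset.range (N + 1), lam ^ k / 4 ^ k * #(loopsNC k)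
      ≤ ∑ k ∈ Finset.range (N + 1), lam ^ k / 4 ^ k *
          ∑ u : Dir 2, ∑ r ∈ Finset.range (N + 1), (#(fsLoops k r u) : ℝ) := by
        refine Finset.sum_le_sum fun k hk => mul_le_mul_of_nonneg_left ?_ (by positivity)
        have hkN : k + 1 ≤ N + 1 := Nat.succ_le_succ (Nat.le_of_lt_succ (Finset.mem_range.1 hk))
        calc (#(loopsNC k) : ℝ) ≤ ∑ u : Dir 2, ∑ r ∈ Finset.range (k + 1), (#(fsLoops k r u) : ℝ) := by
              exact_mod_cast card_loopsNC_le k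
          _ ≤ ∑ u : Dir 2, ∑ r ∈ Finset.range (N + 1), (#(fsLoops k r u) : ℝ) :=
              Finset.sum_le_sum fun u _ => Finset.sum_le_sum_of_subset_of_nonneg
                (Finset.range_subset_range.2 hkN) fun r _ _ => Nat.cast_nonneg _
    _ = ∑ u : Dir 2, ∑ r ∈ Finset.range (N + 1),
          ∑ k ∈ Finset.range (N + 1), lam ^ k / 4 ^ k * #(fsLoops k r u) := by
        have h : ∀ k : ℕ, lam ^ k / 4 ^ k * ∑ u : Dir 2, ∑ r ∈ Finset.range (N + 1),
            (#(fsLoops k r u) : ℝ) =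
            ∑ u : Dir 2, ∑ r ∈ Finset.range (N + 1), lam ^ k / 4 ^ k * #(fsLoops k r u) := by
          intro k
          rw [Finset.mul_sum]
          refine Finset.sum_congr rfl fun u _ => ?_
          rw [Finset.mul_sum]
        rw [Finset.sum_congr rfl fun k _ => h k, Finset.sum_comm]
        refine Finset.sum_congr rfl fun u _ => ?_
        rw [Finset.sum_comm]
    _ ≤ ∑ _u : Dir 2, ∑ r ∈ Finset.range (N + 1), (3 / 4 : ℝ) ^ r :=
        Finset.sum_le_sum fun u _ => Finset.sum_le_sum fun r _ =>
          sum_pow_div_card_fsLoops_le hl0 hl1 u N r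
    _ ≤ ∑ _u : Dir 2, (4 : ℝ) := Finset.sum_le_sum fun u _ => hgeom
    _ = 16 := by rw [Finset.sum_const, Finset.card_univ, card_dir]; norm_num

/-! ### The multiplicity bound -/

/-- **Removing the multiplicity of the root** (Lawler's Prop. 3.6.3, finite form): for `n ≥ 1`,
`0 ≤ λ ≤ 1`, every finite `A₂` and every `N`,
`Σ_{t ≤ N} (1-λ)λ^t/4^t Σ_{β} q_n(0; A₂ ∪ verts β) ≤ 16 Σ_{t ≤ N} (1-λ)λ^t/4^t Σ_{β ∈ noRet t} q_n(0; A₂ ∪ verts β)`.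
[cite: Lawler1991, Prop. 3.6.3] -/
theorem sum_escProb_le_sixteen_mul {n : ℕ} (hn : 1 ≤ n) {lam : ℝ} (hl0 : 0 ≤ lam) (hl1 : lam ≤ 1)
    (N : ℕ) (A₂ : Finset (Site 2)) :
    ∑ t ∈ Finset.range (N + 1), (1 - lam) * lam ^ t / 4 ^ t *
        ∑ β : StepSeq 2 t, escProb n 0 (A₂ ∪ verts β) ≤
      16 * ∑ t ∈ Finset.range (N + 1), (1 - lam) * lam ^ t / 4 ^ t *
        ∑ β ∈ noRet t, escProb n 0 (A₂ ∪ verts β) := by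
  set R : ℕ → ℝ := fun s => ∑ β ∈ noRet s, escProb n 0 (A₂ ∪ verts β) with hR
  have hR0 : ∀ s, 0 ≤ R s := fun s => Finset.sum_nonneg fun β _ => escProb_nonneg _ _ _
  set a : ℕ → ℝ := fun k => lam ^ k / 4 ^ k * #(loopsNC k) with ha
  set b : ℕ → ℝ := fun s => lam ^ s / 4 ^ s * R s with hb
  have ha0 : ∀ k, 0 ≤ a k := fun k => by rw [ha]; positivity
  have hb0 : ∀ s, 0 ≤ b s := fun s => by rw [hb]; exact mul_nonneg (by positivity) (hR0 s)
  have h1l : 0 ≤ 1 - lam := by linarith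
  calc ∑ t ∈ Finset.range (N + 1), (1 - lam) * lam ^ t / 4 ^ t *
          ∑ β : StepSeq 2 t, escProb n 0 (A₂ ∪ verts β)
      ≤ ∑ t ∈ Finset.range (N + 1), (1 - lam) * lam ^ t / 4 ^ t *
          ∑ k ∈ Finset.range (t + 1), (#(loopsNC k) : ℝ) * R (t - k) := by
        refine Finset.sum_le_sum fun t _ => mul_le_mul_of_nonneg_left
          (sum_escProb_le_sum_card_loopsNC_mul hn t A₂) ?_
        exact div_nonneg (mul_nonneg h1l (pow_nonneg hl0 t)) (by positivity)
    _ = (1 - lam) * ∑ t ∈ Finset.range (N + 1), ∑ k ∈ Finset.range (t + 1), a k * b (t - k) := by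
        rw [Finset.mul_sum]
        refine Finset.sum_congr rfl fun t _ => ?_
        rw [Finset.mul_sum, Finset.mul_sum]
        refine Finset.sum_congr rfl fun k hk => ?_
        have hkt : k ≤ t := Nat.le_of_lt_succ (Finset.mem_range.1 hk)
        rw [ha, hb]
        dsimp only
        rw [mul_div_assoc, pow_div_pow_eq_mul hkt (lam := lam)]
        ring
    _ ≤ (1 - lam) * ((∑ k ∈ Finset.range (N + 1), a k) * ∑ s ∈ Finset.range (N + 1), b s) :=
        mul_le_mul_of_nonneg_left (sum_sum_mul_sub_le ha0 hb0 N) h1l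
    _ ≤ (1 - lam) * (16 * ∑ s ∈ Finset.range (N + 1), b s) := by
        refine mul_le_mul_of_nonneg_left (mul_le_mul_of_nonneg_right ?_
          (Finset.sum_nonneg fun s _ => hb0 s)) h1l
        exact sum_pow_div_card_loopsNC_le hl0 hl1 N
    _ = 16 * ∑ t ∈ Finset.range (N + 1), (1 - lam) * lam ^ t / 4 ^ t * R t := by
        rw [Finset.mul_sum, Finset.mul_sum, Finset.mul_sum]
        refine Finset.sum_congr rfl fun s _ => ?_
        rw [hb]
        ring

end PlaneNonIntersection

end Literature.Probability.RandomPlanarGeometry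

end
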